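import Literature.Dynamics.SymbolicDynamics.Hochman2025GluingGeom
import HarnessLib

/-!
# Hochman 2025, §6.3 Steps A–B: the kept frames and the relocation of their witnesses

For the gluing of `y|_J` into `x` on the outer far region (§6 of M. Hochman, *Irreducibility and
periodicity in `ℤ²` symbolic systems*, Discrete Analysis 2025:17), frames of the certificates
`Cx, Cy` of `x, y` are *kept* (Steps A and B of §6.3) when their centre is deep inside their own
zone, and each kept witness `w` is replaced by the point `w'` of its safe path `γ` that lies in
the gap `Ê` and is closest to the centre of the frame (or kept as it is when `γ ∩ Ê = ∅`).
This file sets this up on top of the zones of `Hochman2025GluingGeom.lean`: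

* `Gluing.Large P J n` (`rₙ > 40 (diam J + 62)`; then the `y`-zone has diameter `< rₙ/20`,
  `norm_sub_lt_of_V_large`), the level `n₀` of the paper being the least large level;
* the safe path of a witness of a valid certificate (`exists_witnessPath`, from Prop. 4.1 (3):
  `wpath`), its slope `≤ 1/10` (`K0_famScales_le`), the world curve `Frame.curve` of a path in
  frame coordinates and the section index of an abscissa (`sectIdx`);
* **the relocation rule** (§6.3 Step A (1)–(2)): `Tset` = abscissae of the box at which the curve
  meets the gap, `sStar` = the largest one (closest to the centre) if any, else the abscissa of
  the witness; `newW`, `newσ` the relocated witness and its section; basic facts: the relocated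
  witness lies on the path, in its box and section (`newW_mem_sect`, via `path_in_box`), at a gap
  point when moved (`newW_mem_gap_of_nonempty`), and **the part of the curve inward of it misses the
  gap** (`curve_not_mem_gap_of_gt`), hence lies in one zone (`inward_subset_U_or_V`);
* the keeping predicates `KeepX`, `KeepY` (Step A: own-zone depth `≥ 0.3 rₙ + 40`; Step B: all
  `x`-frames at large levels), the relocated frames `relocFrame` and the *kept certificate*
  `Ckept` with its structural well-formedness `Ckept_wf` (centre separation across the two
  certificates from the depth of the centres, `norm_sub_gt_of_α_β`).

The safety of the relocated witnesses (Claims 6.2–6.5) is proved in `Hochman2025Claims.lean`.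

## References

* [Hochman2025] M. Hochman, op. cit., §6.3 Steps A–B (pp. 29–33). Read via
  `lit read arxiv:2401.02273`.
-/

noncomputable section

open Set Metric Complex

namespace Literature.Dynamics.SymbolicDynamics

namespace Hochman2025

namespace Gluing

open scoped NNReal

variable {P : Params}

/-! ### Large and small levels -/

/-- **Large levels**: `rₙ > 40 (diam J + 62)` (the levels `n ≥ n₀` of §6.3, where only frames of
`Cx` are kept). [cite: Hochman2025, §6.3 ("`n₀ = min {n | diam Ê_y < rₙ/10}`")] -/
def Large (P : Params) (J : Finset (ℤ × ℤ)) (n : ℕ) : Prop := 40 * ((ldiam J : ℝ) + 62) < P.r n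

variable {J : Finset (ℤ × ℤ)}

/-- Large levels are upward closed. [folklore] -/
theorem Large.mono (hP : P.Good) {n m : ℕ} (h : Large P J n) (hnm : n ≤ m) : Large P J m :=
  lt_of_lt_of_le h (Params.r_mono hP hnm)

/-- At a small level the glued set is big: `diam J ≥ rₙ/40 - 62`. [folklore] -/
theorem ldiam_ge_of_not_large {n : ℕ} (h : ¬ Large P J n) : P.r n / 40 - 62 ≤ (ldiam J : ℝ) := by
  unfold Large at h; push Not at h; linarith

/-- **Non-outer sites lie in the `20`-neighbourhood of the bounding box of `J`.** [folklore] -/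
theorem mem_box_of_not_mem_outer (hJ : J.Nonempty) {u : ℤ × ℤ} (hu : u ∉ Outer 20 J) :
    minFst J hJ - 20 ≤ u.1 ∧ u.1 ≤ maxFst J hJ + 20 ∧ minSnd J hJ - 20 ≤ u.2 ∧ u.2 ≤ maxSnd J hJ + 20 := by
  by_contra hcon
  apply hu
  have hfar : u ∈ Far 20 J := by
    rw [mem_far_iff]
    intro q hq
    have h1 := minFst_le hJ hq; have h2 := le_maxFst hJ hq
    have h3 := minSnd_le hJ hq; have h4 := le_maxSnd hJ hq
    rw [not_and_or, not_and_or, not_and_or] at hcon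
    rcases hcon with h | h | h | h <;> push Not at h
    · exact le_ldist_of_le_fst (by rw [abs_of_nonpos (by omega)]; push_cast; omega)
    · exact le_ldist_of_le_fst (by rw [abs_of_nonneg (by omega)]; push_cast; omega)
    · exact le_ldist_of_le_snd (by rw [abs_of_nonpos (by omega)]; push_cast; omega)
    · exact le_ldist_of_le_snd (by rw [abs_of_nonneg (by omega)]; push_cast; omega)
  apply mem_outer_of_not_inside (by norm_num) hJ hfar
  obtain ⟨q, hq⟩ := hJ
  have h1 := minFst_le ⟨q, hq⟩ hq; have h2 := le_maxFst ⟨q, hq⟩ hq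
  have h3 := minSnd_le ⟨q, hq⟩ hq; have h4 := le_maxSnd ⟨q, hq⟩ hq
  omega

/-- Points of the `y`-zone have coordinates in the `21`-neighbourhood of the bounding box.
[folklore] -/
theorem re_im_mem_of_V (hJ : J.Nonempty) {p : ℂ} (hp : p ∈ V J) :
    (minFst J hJ : ℝ) - 20 ≤ p.re ∧ p.re ≤ maxFst J hJ + 21 ∧
      (minSnd J hJ : ℝ) - 20 ≤ p.im ∧ p.im ≤ maxSnd J hJ + 21 := by
  have hβ : 21 / 2 < β J p := hp
  have hsite := site_not_mem_outer_of_one_le_β (J := J) (p := p) (by linarith)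
  obtain ⟨h1, h2, h3, h4⟩ := mem_box_of_not_mem_outer hJ hsite
  simp only [Plane.site] at h1 h2 h3 h4
  have a1 := Int.floor_le p.re; have a2 := Int.lt_floor_add_one p.re
  have b1 := Int.floor_le p.im; have b2 := Int.lt_floor_add_one p.im
  have h1' : ((minFst J hJ - 20 : ℤ) : ℝ) ≤ ⌊p.re⌋ := by exact_mod_cast h1
  have h2' : ((⌊p.re⌋ : ℤ) : ℝ) ≤ ((maxFst J hJ + 20 : ℤ) : ℝ) := by exact_mod_cast h2
  have h3' : ((minSnd J hJ - 20 : ℤ) : ℝ) ≤ ⌊p.im⌋ := by exact_mod_cast h3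
  have h4' : ((⌊p.im⌋ : ℤ) : ℝ) ≤ ((maxSnd J hJ + 20 : ℤ) : ℝ) := by exact_mod_cast h4
  push_cast at h1' h2' h3' h4'
  refine ⟨by linarith, by linarith, by linarith, by linarith⟩

/-- **The `y`-zone is small**: any two of its points are within `2 (diam J + 41)`.
[cite: Hochman2025, §6.3 (Claim 6.4: "the diameter of `Ê ∪ Ê_y` is less than `rₙ/10`")] -/
theorem norm_sub_le_of_V (hJ : J.Nonempty) {p q : ℂ} (hp : p ∈ V J) (hq : q ∈ V J) :
    ‖p - q‖ ≤ 2 * ((ldiam J : ℝ) + 41) := by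
  obtain ⟨p1, p2, p3, p4⟩ := re_im_mem_of_V hJ hp
  obtain ⟨q1, q2, q3, q4⟩ := re_im_mem_of_V hJ hq
  obtain ⟨qa, hqa, hqa'⟩ := Finset.exists_mem_eq_inf' hJ Prod.fst
  obtain ⟨qb, hqb, hqb'⟩ := Finset.exists_mem_eq_sup' hJ Prod.fst
  obtain ⟨qc, hqc, hqc'⟩ := Finset.exists_mem_eq_inf' hJ Prod.snd
  obtain ⟨qd, hqd, hqd'⟩ := Finset.exists_mem_eq_sup' hJ Prod.snd
  have hx : (maxFst J hJ : ℝ) - minFst J hJ ≤ ldiam J := by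
    have h1 := (abs_sub_le_ldist qb qa).1
    have h2 : (ldist qb qa : ℤ) ≤ ldiam J := by exact_mod_cast ldist_le_ldiam hqb hqa
    have : (J.sup' hJ Prod.fst : ℤ) - J.inf' hJ Prod.fst ≤ ldiam J := by
      rw [hqa', hqb']; linarith [le_abs_self (qb.1 - qa.1)]
    have : ((maxFst J hJ - minFst J hJ : ℤ) : ℝ) ≤ ((ldiam J : ℕ) : ℤ) := by exact_mod_cast this
    push_cast at this; exact this
  have hy : (maxSnd J hJ : ℝ) - minSnd J hJ ≤ ldiam J := by
    have h1 := (abs_sub_le_ldist qd qc).2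
    have h2 : (ldist qd qc : ℤ) ≤ ldiam J := by exact_mod_cast ldist_le_ldiam hqd hqc
    have : (J.sup' hJ Prod.snd : ℤ) - J.inf' hJ Prod.snd ≤ ldiam J := by
      rw [hqc', hqd']; linarith [le_abs_self (qd.2 - qc.2)]
    have : ((maxSnd J hJ - minSnd J hJ : ℤ) : ℝ) ≤ ((ldiam J : ℕ) : ℤ) := by exact_mod_cast this
    push_cast at this; exact this
  have hn := Complex.norm_le_abs_re_add_abs_im (p - q)
  simp only [Complex.sub_re, Complex.sub_im] at hn
  have e1 : |p.re - q.re| ≤ (ldiam J : ℝ) + 41 := by rw [abs_le]; constructor <;> linarith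
  have e2 : |p.im - q.im| ≤ (ldiam J : ℝ) + 41 := by rw [abs_le]; constructor <;> linarith
  linarith

/-- At a large level two points of the `y`-zone are within `rₙ/20`. [cite: Hochman2025, §6.3 Step B] -/
theorem norm_sub_lt_of_V_large (hJ : J.Nonempty) {n : ℕ} (hL : Large P J n) {p q : ℂ}
    (hp : p ∈ V J) (hq : q ∈ V J) : ‖p - q‖ < P.r n / 20 := by
  have := norm_sub_le_of_V hJ hp hq
  unfold Large at hL
  linarith

/-! ### The slope of the safe paths -/

/-- **The safe paths of level-`n` boxes have slope `≤ 1/10`** (`K0 = b₀/a₀` of the obstacle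
scales: `h₁/(2ℓ₁)` for `n ≥ 2`, `h₁/(178 r₁)` for `n = 1`). [cite: Hochman2025, §5.2 (`h₁/w₁ ≪ 1`)] -/
theorem K0_famScales_le (hP : P.Good) {n : ℕ} (hn : 1 ≤ n) :
    ((SafePoints.K0 (P.famScales hP n) : ℝ≥0) : ℝ) ≤ 1 / 10 := by
  rw [SafePoints.coe_K0]
  unfold SafePoints.Scales.β Params.famScales
  rw [SafePoints.Scales.extendScales_a_of_lt _ (by omega : 0 < n),
    SafePoints.Scales.extendScales_b_of_lt _ (by omega : 0 < n)]
  unfold Params.famA Params.famB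
  by_cases h1 : 0 + 1 < n
  · rw [if_pos h1, if_pos h1]
    have hℓ := Params.ℓ_pos hP 1
    have hh := hP.h_le_ℓ 1
    rw [div_le_iff₀ (by positivity)]
    linarith
  · rw [if_neg h1, if_neg h1]
    have hn1 : n = 1 := by omega
    subst hn1
    unfold Params.wB
    have hr := P.r_pos 1
    have hh := Params.h_le_r hP (le_refl 1)
    rw [div_le_iff₀ (by positivity)]
    linarith [P.h_pos 1]

/-! ### Safe paths of the witnesses of a valid certificate -/

/-- **Every witness of a valid certificate lies on a safe flat path** (Prop. 4.1 (3) applied to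
the sparse obstacle family of its box). [cite: Hochman2025, §6.3 Step A ("there is a polygonal
path `γ ⊆ safe(R_C(B))` containing `w`")] -/
theorem exists_witnessPath (hP : P.Good) {C : Cert P} (hV : C.Valid hP) {n : ℕ} (hn : 1 ≤ n)
    {G : Frame P n} (hG : G ∈ C.frames n) (j : Fin (P.N n)) :
    ∃ f : ℝ → ℝ, LipschitzWith (SafePoints.K0 (P.famScales hP n)) f ∧
      f (G.φ (G.w j)).1 = (G.φ (G.w j)).2 ∧
      ∀ 𝔉 : Finset SafePoints.Diamond, (↑𝔉 : Set SafePoints.Diamond) = C.familySet G j →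
        ∀ x, (x, f x) ∈ SafePoints.safe (P.famScales hP n) 𝔉 := by
  set 𝔉₀ := (Cert.familySet_finite hP hV.wf hG j).toFinset with h𝔉₀
  have hcoe : (↑𝔉₀ : Set SafePoints.Diamond) = C.familySet G j := Set.Finite.coe_toFinset _
  have hsafe₀ := hV.safe n hn G hG j 𝔉₀ hcoe
  set ρ := SafePoints.RectScales.ofScales (P.famScales hP n) with hρ
  have hρσ : ρ.toScales = P.famScales hP n := SafePoints.RectScales.toScales_ofScales _
  have hgood : ρ.toScales.Good 10 := by rw [hρσ]; exact Params.famScales_good hP n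
  have hsp : SafePoints.RectSparse ρ 𝔉₀ := Cert.familySet_rectSparse hP hV.wf hn G j 𝔉₀ hcoe
  obtain ⟨-, -, h3, -⟩ := SafePoints.prop_4_1 hgood hsp
  rw [hρσ] at h3
  obtain ⟨f, hlip, hthrough, hsafe⟩ := h3 _ hsafe₀
  refine ⟨f, hlip, hthrough, fun 𝔉 h𝔉 x => ?_⟩
  have : 𝔉 = 𝔉₀ := Finset.coe_injective (by rw [h𝔉, hcoe])
  rw [this]
  exact hsafe x

/-- The chosen safe path of a witness. [cite: Hochman2025, §6.3 Step A] -/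
def wpath (hP : P.Good) {C : Cert P} (hV : C.Valid hP) {n : ℕ} (hn : 1 ≤ n)
    {G : Frame P n} (hG : G ∈ C.frames n) (j : Fin (P.N n)) : ℝ → ℝ :=
  Classical.choose (exists_witnessPath hP hV hn hG j)

/-- The chosen path is `K0`-Lipschitz. [cite: Hochman2025, Prop 4.1 (3)] -/
theorem wpath_lip (hP : P.Good) {C : Cert P} (hV : C.Valid hP) {n : ℕ} (hn : 1 ≤ n)
    {G : Frame P n} (hG : G ∈ C.frames n) (j : Fin (P.N n)) :
    LipschitzWith (SafePoints.K0 (P.famScales hP n)) (wpath hP hV hn hG j) :=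
  (Classical.choose_spec (exists_witnessPath hP hV hn hG j)).1

/-- The chosen path passes through the witness. [cite: Hochman2025, Prop 4.1 (3)] -/
theorem wpath_through (hP : P.Good) {C : Cert P} (hV : C.Valid hP) {n : ℕ} (hn : 1 ≤ n)
    {G : Frame P n} (hG : G ∈ C.frames n) (j : Fin (P.N n)) :
    wpath hP hV hn hG j (G.φ (G.w j)).1 = (G.φ (G.w j)).2 :=
  (Classical.choose_spec (exists_witnessPath hP hV hn hG j)).2.1

/-- All points of the chosen path are safe. [cite: Hochman2025, Prop 4.1 (3)] -/
theorem wpath_safe (hP : P.Good) {C : Cert P} (hV : C.Valid hP) {n : ℕ} (hn : 1 ≤ n)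
    {G : Frame P n} (hG : G ∈ C.frames n) (j : Fin (P.N n)) (𝔉 : Finset SafePoints.Diamond)
    (h𝔉 : (↑𝔉 : Set SafePoints.Diamond) = C.familySet G j) (x : ℝ) :
    (x, wpath hP hV hn hG j x) ∈ SafePoints.safe (P.famScales hP n) 𝔉 :=
  (Classical.choose_spec (exists_witnessPath hP hV hn hG j)).2.2 𝔉 h𝔉 x

/-- The chosen path is continuous. [folklore] -/
theorem wpath_continuous (hP : P.Good) {C : Cert P} (hV : C.Valid hP) {n : ℕ} (hn : 1 ≤ n)
    {G : Frame P n} (hG : G ∈ C.frames n) (j : Fin (P.N n)) : Continuous (wpath hP hV hn hG j) :=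
  (wpath_lip hP hV hn hG j).continuous

/-- The chosen path has slope `≤ 1/10`: `|f x - f y| ≤ |x - y| / 10`. [folklore] -/
theorem wpath_slope (hP : P.Good) {C : Cert P} (hV : C.Valid hP) {n : ℕ} (hn : 1 ≤ n)
    {G : Frame P n} (hG : G ∈ C.frames n) (j : Fin (P.N n)) (x y : ℝ) :
    |wpath hP hV hn hG j x - wpath hP hV hn hG j y| ≤ |x - y| / 10 := by
  have h := (wpath_lip hP hV hn hG j).dist_le_mul x y
  rw [Real.dist_eq, Real.dist_eq] at h
  have hK := K0_famScales_le hP hn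
  have : ((SafePoints.K0 (P.famScales hP n) : ℝ≥0) : ℝ) * |x - y| ≤ 1 / 10 * |x - y| :=
    mul_le_mul_of_nonneg_right hK (abs_nonneg _)
  linarith

end Gluing

/-! ### The world curve of a path in frame coordinates -/

namespace Frame

variable {P : Params} {n : ℕ} (G : Frame P n)

/-- The point with frame coordinates `(s, f s)`: the world curve of the graph of `f`.
[cite: Hochman2025, §6.3 Step A (the path `γ`)] -/
def curve (f : ℝ → ℝ) (s : ℝ) : ℂ := G.c + G.v * ((s : ℂ) + (f s : ℂ) * I)

/-- Frame coordinates of `c + v z` are `(re z, im z)`. [folklore] -/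
theorem φ_add_mul (z : ℂ) : G.φ (G.c + G.v * z) = (z.re, z.im) := by
  have hv := G.norm_v
  have hvv : starRingEnd ℂ G.v * G.v = 1 := by
    rw [Complex.conj_mul', hv]; norm_num
  simp only [Frame.φ, Plane.coords, add_sub_cancel_left, ← mul_assoc, hvv, one_mul]

/-- Frame coordinates of the curve: `(s, f s)`. [folklore] -/
@[simp] theorem φ_curve (f : ℝ → ℝ) (s : ℝ) : G.φ (G.curve f s) = (s, f s) := by
  rw [curve, φ_add_mul]
  simp

/-- A point whose frame coordinates lie on the graph is on the curve. [folklore] -/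
theorem curve_φ_fst {f : ℝ → ℝ} {p : ℂ} (h : f (G.φ p).1 = (G.φ p).2) : G.curve f (G.φ p).1 = p := by
  have := Plane.eq_add_mul_coords G.v G.c p G.norm_v
  rw [curve, h]
  exact this.symm

/-- The curve is continuous if `f` is. [folklore] -/
theorem continuous_curve {f : ℝ → ℝ} (hf : Continuous f) : Continuous (G.curve f) := by
  unfold curve
  fun_prop

/-- Distance of a curve point from the centre: at most `|s| + |f s|`. [folklore] -/
theorem norm_curve_sub_c_le (f : ℝ → ℝ) (s : ℝ) : ‖G.curve f s - G.c‖ ≤ |s| + |f s| := by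
  rw [curve, add_sub_cancel_left, norm_mul, G.norm_v, one_mul]
  calc ‖(s : ℂ) + (f s : ℂ) * I‖ ≤ ‖(s : ℂ)‖ + ‖(f s : ℂ) * I‖ := norm_add_le _ _
    _ = |s| + |f s| := by simp [Complex.norm_real, Real.norm_eq_abs]

/-- Two curve points are at least as far apart as their abscissae. [folklore] -/
theorem abs_sub_le_norm_curve_sub (f : ℝ → ℝ) (s s' : ℝ) :
    |s - s'| ≤ ‖G.curve f s - G.curve f s'‖ := by
  have h : G.curve f s - G.curve f s' = G.v * (((s - s' : ℝ) : ℂ) + ((f s - f s' : ℝ) : ℂ) * I) := by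
    simp only [curve]; push_cast; ring
  rw [h, norm_mul, G.norm_v, one_mul]
  have := Complex.abs_re_le_norm (((s - s' : ℝ) : ℂ) + ((f s - f s' : ℝ) : ℂ) * I)
  simpa using this

/-- Distance of a curve point from a point with given frame coordinates: at most the `ℓ¹`
distance of the coordinates. [folklore] -/
theorem norm_curve_sub_le (f : ℝ → ℝ) (s : ℝ) (q : ℂ) :
    ‖G.curve f s - q‖ ≤ |s - (G.φ q).1| + |f s - (G.φ q).2| := by
  have := Plane.norm_sub_le_coords G.v G.c (G.curve f s) q G.norm_v
  change ‖G.curve f s - q‖ ≤ |(G.φ (G.curve f s)).1 - (G.φ q).1| + |(G.φ (G.curve f s)).2 - (G.φ q).2| at this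
  rw [φ_curve] at this
  exact this

end Frame

namespace Gluing

variable {P : Params}

/-! ### Sections by abscissa -/

/-- The index of the section containing the abscissa `s` of a level-`n` box (clamped to the
last section at the far end). [cite: Hochman2025, §5.3 (sections numbered from the centre)] -/
def sectIdx (hP : P.Good) (n : ℕ) (s : ℝ) : Fin P.S :=
  ⟨min (P.S - 1) ⌊(-(P.r n / 10) - s) / P.ℓ n⌋₊, by
    have hS : 0 < P.S := lt_of_lt_of_le (by norm_num) hP.S_le
    omega⟩

/-- **The section of an abscissa of the box contains it.** [cite: Hochman2025, §5.3] -/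
theorem sectIdx_bounds (hP : P.Good) (n : ℕ) {s : ℝ} (hs : s ∈ Icc (-(99 / 100 * P.r n)) (-(P.r n / 10))) :
    -(P.r n / 10) - (((sectIdx hP n s : ℕ) : ℝ) + 1) * P.ℓ n ≤ s ∧
      s ≤ -(P.r n / 10) - ((sectIdx hP n s : ℕ) : ℝ) * P.ℓ n := by
  have hℓ := Params.ℓ_pos hP n
  have hS : 0 < P.S := lt_of_lt_of_le (by norm_num) hP.S_le
  set u := (-(P.r n / 10) - s) / P.ℓ n with hu
  have hu0 : 0 ≤ u := div_nonneg (by linarith [hs.2]) hℓ.le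
  have hsu : s = -(P.r n / 10) - u * P.ℓ n := by rw [hu]; field_simp; ring
  have huS : u ≤ P.S := by
    rw [hu, div_le_iff₀ hℓ]
    have : (P.S : ℝ) * P.ℓ n = 89 / 100 * P.r n := by
      unfold Params.ℓ Params.wB
      field_simp
    rw [this]; linarith [hs.1]
  have hidx : ((sectIdx hP n s : ℕ) : ℝ) = ((min (P.S - 1) ⌊u⌋₊ : ℕ) : ℝ) := rfl
  have hfl := Nat.floor_le hu0
  have hlt := Nat.lt_floor_add_one u
  by_cases hcase : ⌊u⌋₊ ≤ P.S - 1
  · rw [min_eq_right hcase] at hidx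
    rw [hidx, hsu]
    constructor
    · nlinarith
    · nlinarith
  · push Not at hcase
    rw [min_eq_left hcase.le] at hidx
    have hS1 : ((P.S - 1 : ℕ) : ℝ) = (P.S : ℝ) - 1 := by
      rw [Nat.cast_sub (by omega)]; simp
    rw [hidx, hS1, hsu]
    have hfl' : (P.S : ℝ) - 1 < ⌊u⌋₊ := by
      have : ((P.S - 1 : ℕ) : ℝ) < ((⌊u⌋₊ : ℕ) : ℝ) := by exact_mod_cast hcase
      rw [hS1] at this; exact this
    constructor
    · nlinarith
    · nlinarith

/-- A point with frame coordinates `(s, y)`, `s` in the box range and `y ∈ [t, t + h]`, lies in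
section `sectIdx s` of the box. [cite: Hochman2025, §5.3] -/
theorem mem_sect_of_φ (hP : P.Good) {n : ℕ} (G : Frame P n) (j : Fin (P.N n)) {p : ℂ}
    (hs : (G.φ p).1 ∈ Icc (-(99 / 100 * P.r n)) (-(P.r n / 10)))
    (hy : G.t j ≤ (G.φ p).2 ∧ (G.φ p).2 ≤ G.t j + P.h n) :
    p ∈ G.sect j (sectIdx hP n (G.φ p).1) := by
  obtain ⟨h1, h2⟩ := sectIdx_bounds hP n hs
  have hℓ : 89 / 100 * P.r n / P.S = P.ℓ n := rfl
  refine ⟨?_, ?_, hy.1, hy.2⟩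
  · change -(P.r n / 10) - (((sectIdx hP n (G.φ p).1 : ℕ) : ℝ) + 1) * (89 / 100 * P.r n / P.S) ≤ (G.φ p).1
    rw [hℓ]; exact h1
  · change (G.φ p).1 ≤ -(P.r n / 10) - ((sectIdx hP n (G.φ p).1 : ℕ) : ℝ) * (89 / 100 * P.r n / P.S)
    rw [hℓ]; exact h2

/-- The abscissa of a point of a section lies in the box range. [cite: Hochman2025, §5.3] -/
theorem φ_fst_mem_Icc_of_mem_sect (hP : P.Good) {n : ℕ} (G : Frame P n) {j : Fin (P.N n)} {i : Fin P.S}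
    {p : ℂ} (hp : p ∈ G.sect j i) : (G.φ p).1 ∈ Icc (-(99 / 100 * P.r n)) (-(P.r n / 10)) := by
  have hS : 0 < P.S := lt_of_lt_of_le (by norm_num) hP.S_le
  have hbox := Plane.section_subset_box G.v G.c (P.r_pos n).le hS i hp
  exact ⟨hbox.1, hbox.2.1⟩

/-! ### The relocation rule (§6.3 Step A (1)–(2)) -/

section Reloc

variable (J : Finset (ℤ × ℤ)) {n : ℕ} (G : Frame P n) (f : ℝ → ℝ)

/-- The abscissae of the box at which the curve of `f` meets the gap. [cite: Hochman2025, §6.3 Step A (2)] -/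
def Tset : Set ℝ := {s | s ∈ Icc (-(99 / 100 * P.r n)) (-(P.r n / 10)) ∧ G.curve f s ∈ Gap J}

variable {J G f}

/-- `Tset` lies in the box range. [folklore] -/
theorem Tset_subset_Icc : Tset J G f ⊆ Icc (-(99 / 100 * P.r n)) (-(P.r n / 10)) := fun _ hs => hs.1

/-- `Tset` is bounded above. [folklore] -/
theorem Tset_bddAbove : BddAbove (Tset J G f) := ⟨-(P.r n / 10), fun _ hs => hs.1.2⟩

/-- `Tset` is closed. [folklore] -/
theorem isClosed_Tset (hJ : J.Nonempty) (hf : Continuous f) : IsClosed (Tset J G f) :=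
  isClosed_Icc.inter ((isClosed_gap hJ).preimage (G.continuous_curve hf))

/-- The supremum of a non-empty `Tset` belongs to it. [folklore] -/
theorem sSup_mem_Tset (hJ : J.Nonempty) (hf : Continuous f) (hne : (Tset J G f).Nonempty) :
    sSup (Tset J G f) ∈ Tset J G f :=
  (isClosed_Tset hJ hf).csSup_mem hne Tset_bddAbove

variable (J G f)

open Classical in
/-- **The abscissa of the relocated witness**: the largest abscissa at which the curve meets
the gap (the gap point of `γ` closest to the centre), or the abscissa of the original witness
`w` when the curve misses the gap over the box. [cite: Hochman2025, §6.3 Step A (1)–(2)] -/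
def sStar (w : ℂ) : ℝ :=
  if (Tset J G f).Nonempty then sSup (Tset J G f) else (G.φ w).1

/-- **The relocated witness `w'`.** [cite: Hochman2025, §6.3 Step A (1)–(2)] -/
def newW (w : ℂ) : ℂ := G.curve f (sStar J G f w)

open Classical in
/-- **The section of the relocated witness** (unchanged when the witness is). [cite: Hochman2025, §6.3 Step A] -/
def newσ (hP : P.Good) (w : ℂ) (σ : Fin P.S) : Fin P.S :=
  if (Tset J G f).Nonempty then sectIdx hP n (sStar J G f w) else σ

variable {J G f}

/-- When the curve misses the gap, the witness is unchanged. [cite: Hochman2025, §6.3 Step A (1)] -/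
theorem newW_of_empty {w : ℂ} (hne : ¬ (Tset J G f).Nonempty) (hw : f (G.φ w).1 = (G.φ w).2) :
    newW J G f w = w := by
  simp only [newW, sStar, if_neg hne]
  exact G.curve_φ_fst hw

/-- When the curve misses the gap, the section is unchanged. [cite: Hochman2025, §6.3 Step A (1)] -/
theorem newσ_of_empty (hP : P.Good) (w : ℂ) (σ : Fin P.S) (hne : ¬ (Tset J G f).Nonempty) :
    newσ J G f hP w σ = σ := by simp only [newσ, if_neg hne]

/-- The abscissa of the relocated witness lies in the box range (given that the original witness
does). [folklore] -/
theorem sStar_mem_Icc (hJ : J.Nonempty) (hf : Continuous f) {w : ℂ}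
    (hw : (G.φ w).1 ∈ Icc (-(99 / 100 * P.r n)) (-(P.r n / 10))) :
    sStar J G f w ∈ Icc (-(99 / 100 * P.r n)) (-(P.r n / 10)) := by
  unfold sStar
  split_ifs with h
  · exact (sSup_mem_Tset hJ hf h).1
  · exact hw

/-- Frame coordinates of the relocated witness. [folklore] -/
@[simp] theorem φ_newW (w : ℂ) : G.φ (newW J G f w) = (sStar J G f w, f (sStar J G f w)) :=
  G.φ_curve f _

/-- **A moved witness is a gap point.** [cite: Hochman2025, §6.3 Step A (2)] -/
theorem newW_mem_gap_of_nonempty (hJ : J.Nonempty) (hf : Continuous f) {w : ℂ}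
    (hne : (Tset J G f).Nonempty) : newW J G f w ∈ Gap J := by
  simp only [newW, sStar, if_pos hne]
  exact (sSup_mem_Tset hJ hf hne).2

/-- **Inward of the relocated witness the curve misses the gap.** [cite: Hochman2025, §6.3 Step A
("the new point ... is closer to the center of `F'` than `w'` was, contradicting the definition of `w'`")] -/
theorem curve_not_mem_gap_of_gt {w : ℂ} {s : ℝ} (hs1 : sStar J G f w < s) (hs2 : s ≤ -(P.r n / 10))
    (hs0 : -(99 / 100 * P.r n) ≤ s) : G.curve f s ∉ Gap J := by
  intro hgap
  have hmem : s ∈ Tset J G f := ⟨⟨hs0, hs2⟩, hgap⟩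
  have hne : (Tset J G f).Nonempty := ⟨s, hmem⟩
  simp only [sStar, if_pos hne] at hs1
  exact absurd (le_csSup Tset_bddAbove hmem) (not_le.mpr hs1)

/-- When the witness is not moved, the whole curve over the box misses the gap. [cite: Hochman2025, §6.3 Step A (1)] -/
theorem curve_not_mem_gap_of_empty (hne : ¬ (Tset J G f).Nonempty) {s : ℝ}
    (hs : s ∈ Icc (-(99 / 100 * P.r n)) (-(P.r n / 10))) : G.curve f s ∉ Gap J :=
  fun hgap => hne ⟨s, hs, hgap⟩

/-- **The inward part of the curve lies in one zone.** [cite: Hochman2025, §6.3 Step A (Claim 6.3, end)] -/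
theorem inward_subset_U_or_V (hJ : J.Nonempty) (hf : Continuous f) {w : ℂ}
    (hw : -(99 / 100 * P.r n) ≤ sStar J G f w) :
    G.curve f '' Ioc (sStar J G f w) (-(P.r n / 10)) ⊆ U J ∨
      G.curve f '' Ioc (sStar J G f w) (-(P.r n / 10)) ⊆ V J := by
  apply subset_U_or_V hJ (isPreconnected_Ioc.image _ (G.continuous_curve hf).continuousOn)
  rw [Set.disjoint_left]
  rintro _ ⟨s, hs, rfl⟩ hgap
  exact curve_not_mem_gap_of_gt hs.1 hs.2 (by linarith [hs.1]) hgap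

/-- When the witness is not moved, the whole curve over the box lies in one zone. [cite: Hochman2025, §6.3 Step A (1)] -/
theorem whole_subset_U_or_V (hJ : J.Nonempty) (hf : Continuous f) (hne : ¬ (Tset J G f).Nonempty) :
    G.curve f '' Icc (-(99 / 100 * P.r n)) (-(P.r n / 10)) ⊆ U J ∨
      G.curve f '' Icc (-(99 / 100 * P.r n)) (-(P.r n / 10)) ⊆ V J := by
  apply subset_U_or_V hJ (isPreconnected_Icc.image _ (G.continuous_curve hf).continuousOn)
  rw [Set.disjoint_left]
  rintro _ ⟨s, hs, rfl⟩ hgap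
  exact curve_not_mem_gap_of_empty hne hs hgap

end Reloc

/-! ### Kept frames and the kept certificate -/

section Kept

variable (hP : P.Good) (J : Finset (ℤ × ℤ)) {Cx Cy : Cert P} (hVx : Cx.Valid hP) (hVy : Cy.Valid hP)

/-- **Step A/B keeping rule for `x`-frames**: all at large levels; at small levels those whose
centre is `0.3 rₙ + 40` deep in the `x`-zone. [cite: Hochman2025, §6.3 Steps A–B] -/
def KeepX (n : ℕ) (G : Frame P n) : Prop := Large P J n ∨ 3 / 10 * P.r n + 40 ≤ α J G.c

/-- **Step A keeping rule for `y`-frames**: small level and centre `0.3 rₙ + 40` deep in the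
`y`-zone. [cite: Hochman2025, §6.3 Step A] -/
def KeepY (n : ℕ) (G : Frame P n) : Prop := ¬ Large P J n ∧ 3 / 10 * P.r n + 40 ≤ β J G.c

/-- The relocated version of a frame of a valid certificate (same geometry, witnesses moved by
the relocation rule along their chosen safe paths). [cite: Hochman2025, §6.3 Step A ("`F'` ... with
the same center and the same boxes as `F`, but possibly different witnesses")] -/
def relocFrame {C : Cert P} (hV : C.Valid hP) {n : ℕ} (hn : 1 ≤ n) (G : Frame P n)
    (hG : G ∈ C.frames n) : Frame P n where
  c := G.c
  k := G.k
  t := G.t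
  w j := newW J G (wpath hP hV hn hG j) (G.w j)
  σ j := newσ J G (wpath hP hV hn hG j) hP (G.w j) (G.σ j)

/-- **The kept certificate** `C_kept`: the kept frames of both certificates, relocated.
[cite: Hochman2025, §6.3 Steps A–B] -/
def Ckept : Cert P where
  frames n := {F | ∃ (hn : 1 ≤ n) (G : Frame P n) (hG : G ∈ Cx.frames n),
      KeepX J n G ∧ F = relocFrame hP J hVx hn G hG} ∪
    {F | ∃ (hn : 1 ≤ n) (G : Frame P n) (hG : G ∈ Cy.frames n),
      KeepY J n G ∧ F = relocFrame hP J hVy hn G hG}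

variable {hP J hVx hVy}

/-- Membership in the kept certificate. [folklore] -/
theorem mem_Ckept {n : ℕ} {F : Frame P n} :
    F ∈ (Ckept hP J hVx hVy).frames n ↔
      (∃ (hn : 1 ≤ n) (G : Frame P n) (hG : G ∈ Cx.frames n), KeepX J n G ∧ F = relocFrame hP J hVx hn G hG) ∨
      (∃ (hn : 1 ≤ n) (G : Frame P n) (hG : G ∈ Cy.frames n), KeepY J n G ∧ F = relocFrame hP J hVy hn G hG) :=
  Iff.rfl

/-- Kept `x`-frames are frames of the kept certificate. [folklore] -/
theorem relocFrame_mem_Ckept_x {n : ℕ} (hn : 1 ≤ n) {G : Frame P n} (hG : G ∈ Cx.frames n)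
    (hK : KeepX J n G) : relocFrame hP J hVx hn G hG ∈ (Ckept hP J hVx hVy).frames n :=
  Or.inl ⟨hn, G, hG, hK, rfl⟩

/-- Kept `y`-frames are frames of the kept certificate. [folklore] -/
theorem relocFrame_mem_Ckept_y {n : ℕ} (hn : 1 ≤ n) {G : Frame P n} (hG : G ∈ Cy.frames n)
    (hK : KeepY J n G) : relocFrame hP J hVy hn G hG ∈ (Ckept hP J hVx hVy).frames n :=
  Or.inr ⟨hn, G, hG, hK, rfl⟩

/-- The relocated frame has the same geometry. [folklore] -/
theorem relocFrame_sameGeom {C : Cert P} (hV : C.Valid hP) {n : ℕ} (hn : 1 ≤ n) (G : Frame P n)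
    (hG : G ∈ C.frames n) : Cert.SameGeom G (relocFrame hP J hV hn G hG) := ⟨rfl, rfl, rfl⟩

/-- Frame coordinates of the relocated frame are those of the original. [folklore] -/
@[simp] theorem relocFrame_φ {C : Cert P} (hV : C.Valid hP) {n : ℕ} (hn : 1 ≤ n) (G : Frame P n)
    (hG : G ∈ C.frames n) : (relocFrame hP J hV hn G hG).φ = G.φ :=
  ((relocFrame_sameGeom (J := J) hV hn G hG).φ_eq).symm

/-- The relocated frame has the same centre. [folklore] -/
@[simp] theorem relocFrame_c {C : Cert P} (hV : C.Valid hP) {n : ℕ} (hn : 1 ≤ n) (G : Frame P n)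
    (hG : G ∈ C.frames n) : (relocFrame hP J hV hn G hG).c = G.c := rfl

/-- The relocated frame has the same orientation index. [folklore] -/
@[simp] theorem relocFrame_k {C : Cert P} (hV : C.Valid hP) {n : ℕ} (hn : 1 ≤ n) (G : Frame P n)
    (hG : G ∈ C.frames n) : (relocFrame hP J hV hn G hG).k = G.k := rfl

/-- The relocated frame has the same offsets. [folklore] -/
@[simp] theorem relocFrame_t {C : Cert P} (hV : C.Valid hP) {n : ℕ} (hn : 1 ≤ n) (G : Frame P n)
    (hG : G ∈ C.frames n) : (relocFrame hP J hV hn G hG).t = G.t := rfl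

/-- The witnesses of the relocated frame. [folklore] -/
@[simp] theorem relocFrame_w {C : Cert P} (hV : C.Valid hP) {n : ℕ} (hn : 1 ≤ n) (G : Frame P n)
    (hG : G ∈ C.frames n) (j : Fin (P.N n)) :
    (relocFrame hP J hV hn G hG).w j = newW J G (wpath hP hV hn hG j) (G.w j) := rfl

/-- The sections of the relocated frame. [folklore] -/
@[simp] theorem relocFrame_σ {C : Cert P} (hV : C.Valid hP) {n : ℕ} (hn : 1 ≤ n) (G : Frame P n)
    (hG : G ∈ C.frames n) (j : Fin (P.N n)) :
    (relocFrame hP J hV hn G hG).σ j = newσ J G (wpath hP hV hn hG j) hP (G.w j) (G.σ j) := rfl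

/-- The abscissa of the original witness lies in the box range. [folklore] -/
theorem φ_w_fst_mem_Icc {C : Cert P} (hV : C.Valid hP) {n : ℕ} {G : Frame P n}
    (hG : G ∈ C.frames n) (j : Fin (P.N n)) :
    (G.φ (G.w j)).1 ∈ Icc (-(99 / 100 * P.r n)) (-(P.r n / 10)) :=
  φ_fst_mem_Icc_of_mem_sect hP G ((hV.wf.frame n G hG).wit j)

/-- **The relocated witness has height strictly inside its box** (safe paths stay inside their
box). [cite: Hochman2025, §6.3 Step A ("`γ` ... does not cross the long edges of `B`")] -/
theorem height_newW {C : Cert P} (hV : C.Valid hP) {n : ℕ} (hn : 1 ≤ n)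
    {G : Frame P n} (hG : G ∈ C.frames n) (j : Fin (P.N n)) {s : ℝ}
    (hs : s ∈ Icc (-(99 / 100 * P.r n)) (-(P.r n / 10))) :
    G.t j + P.h n / 100 < wpath hP hV hn hG j s ∧ wpath hP hV hn hG j s < G.t j + P.h n - P.h n / 100 := by
  set 𝔉₀ := (Cert.familySet_finite hP hV.wf hG j).toFinset with h𝔉₀
  have hcoe : (↑𝔉₀ : Set SafePoints.Diamond) = C.familySet G j := Set.Finite.coe_toFinset _
  have hwit := (hV.wf.frame n G hG).wit j
  exact Cert.path_in_box hP hn G j hcoe (wpath_continuous hP hV hn hG j)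
    (wpath_safe hP hV hn hG j 𝔉₀ hcoe) (φ_w_fst_mem_Icc hV hG j)
    (by rw [wpath_through]; exact ⟨hwit.2.2.1, hwit.2.2.2⟩) hs

/-- **The relocated witness lies in its section.** [cite: Hochman2025, §6.3 Step A] -/
theorem newW_mem_sect (hJ : J.Nonempty) {C : Cert P} (hV : C.Valid hP) {n : ℕ} (hn : 1 ≤ n)
    {G : Frame P n} (hG : G ∈ C.frames n) (j : Fin (P.N n)) :
    newW J G (wpath hP hV hn hG j) (G.w j) ∈
      G.sect j (newσ J G (wpath hP hV hn hG j) hP (G.w j) (G.σ j)) := by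
  set f := wpath hP hV hn hG j with hf
  by_cases hne : (Tset J G f).Nonempty
  · simp only [newσ, if_pos hne]
    have hs : sStar J G f (G.w j) ∈ Icc (-(99 / 100 * P.r n)) (-(P.r n / 10)) :=
      sStar_mem_Icc hJ (wpath_continuous hP hV hn hG j) (φ_w_fst_mem_Icc hV hG j)
    have hφ : (G.φ (newW J G f (G.w j))).1 = sStar J G f (G.w j) := by rw [φ_newW]
    have key := mem_sect_of_φ hP G j (p := newW J G f (G.w j)) (by rw [hφ]; exact hs) (by
      rw [φ_newW]
      have := height_newW hV hn hG j hs
      have hh := P.h_pos n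
      exact ⟨by linarith [this.1], by linarith [this.2]⟩)
    rwa [hφ] at key
  · rw [newσ_of_empty hP (G.w j) (G.σ j) hne, newW_of_empty hne (wpath_through hP hV hn hG j)]
    exact (hV.wf.frame n G hG).wit j

/-- **Relocated frames are well formed.** [cite: Hochman2025, §6.3 Step A ("the boxes in `F'` come
from those of `F`")] -/
theorem relocFrame_wf (hJ : J.Nonempty) {C : Cert P} (hV : C.Valid hP) {n : ℕ} (hn : 1 ≤ n)
    (G : Frame P n) (hG : G ∈ C.frames n) : (relocFrame hP J hV hn G hG).WF := by
  refine ⟨(hV.wf.frame n G hG).band, (hV.wf.frame n G hG).apart, fun j => ?_⟩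
  have := newW_mem_sect hJ hV hn hG j
  rw [(relocFrame_sameGeom (J := J) hV hn G hG).sect_eq] at this
  exact this

/-- **Centres of kept `x`- and `y`-frames of one small level are `> 0.6 rₙ` apart** (each is
`0.3 rₙ + 40` deep in its own zone). [cite: Hochman2025, §6.3 Step A ("its total length is greater
than `4/3 rₙ`, and certainly more than `½ rₙ`")] -/
theorem norm_sub_gt_of_keepX_keepY {n : ℕ} {Gx Gy : Frame P n} (hx : KeepX J n Gx) (hy : KeepY J n Gy) :
    3 / 5 * P.r n < ‖Gx.c - Gy.c‖ := by
  have hα : 3 / 10 * P.r n + 40 ≤ α J Gx.c := by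
    rcases hx with hL | h
    · exact absurd hL hy.1
    · exact h
  have := norm_sub_gt_of_α_β hα hy.2
  linarith

/-- **The kept certificate is structurally well formed** (frames well formed; centres of one
level `rₙ/2`-separated: within one certificate by assumption, across by depth).
[cite: Hochman2025, §6.3 Step A (first bullet) and Step B] -/
theorem Ckept_wf (hJ : J.Nonempty) : (Ckept hP J hVx hVy).WF := by
  refine ⟨fun n F hF => ?_, fun n F hF F' hF' hne => ?_⟩
  · rcases mem_Ckept.mp hF with ⟨hn, G, hG, -, rfl⟩ | ⟨hn, G, hG, -, rfl⟩
    · exact relocFrame_wf hJ hVx hn G hG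
    · exact relocFrame_wf hJ hVy hn G hG
  · have hr := P.r_pos n
    rcases mem_Ckept.mp hF with ⟨hn, G, hG, hK, rfl⟩ | ⟨hn, G, hG, hK, rfl⟩ <;>
      rcases mem_Ckept.mp hF' with ⟨hn', G', hG', hK', rfl⟩ | ⟨hn', G', hG', hK', rfl⟩
    · -- both from `Cx`
      have hGG' : G ≠ G' := by rintro rfl; exact hne rfl
      exact hVx.wf.sep n G hG G' hG' hGG'
    · have := norm_sub_gt_of_keepX_keepY hK hK'
      change P.r n / 2 ≤ ‖G.c - G'.c‖
      linarith
    · have := norm_sub_gt_of_keepX_keepY hK' hK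
      change P.r n / 2 ≤ ‖G.c - G'.c‖
      rw [← norm_neg, neg_sub]; linarith
    · have hGG' : G ≠ G' := by rintro rfl; exact hne rfl
      exact hVy.wf.sep n G hG G' hG' hGG'

end Kept

end Gluing

end Hochman2025

end Literature.Dynamics.SymbolicDynamics
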